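import Summits.Ventures.Crystal3D.Theorems.StickyWulffConstantGenericWallFloorBarlowRowLineCount
import HarnessLib

/-!
# Row F4 in lane T's format, part 2″: the ROW | ROW corner in lane T's cell-quantified `hlines` shape (margin absorbed) — the window ROW SETS of the two plates' «++» c-layers are paid by the
# payers, `#T₃ + #T₄ ≤ Σ_PAY (12 − deg)` with the margin `m = 5 + (8/3)(h+4R₀)`
# (crux `GenericWallFloor`, stmt-Ventures-19480, line `WallLedgerG`; lane T's row corner, cf-p1 DECISION (xxxvii⁗), wulff-p2 `…RowStripDefs` v3)

HONEST FRAMING. Venture `Summits/Ventures/Crystal3D` (cell `crystal3d-full`), helper `--supports` the crux `GenericWallFloor`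
(stmt-Ventures-19480) of `route-Ventures-StickyWulffConstant`, registered line `WallLedgerG`, open stub `stub_twoSlabAdhesion`.
Rung credit only; F-C1 not moved; NOT the stub.  Inputs BY NAME: E1 (`ExactOnly`), `DoubleStarCoaxialAt` / `CapPairCoaxial`
(from `StarPairFar`); HYPOTHESES the T-side glue carries: the rows are steep for the plate's inward vertical
(`√2/2 ≤ ⟪L₁ (bestLayerDir L₁ e₃), e₃⟫`, `√2/2 ≤ ⟪L₂ (bestLayerDir L₂ (−e₃)), −e₃⟫` — lane T's `RowSteep`, by `inner_bestLayerDir`)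
and the OFF-REGISTRY hypotheses for the two ROW reach sets (`hoff₁`, `hoff₂`, `hdisjR`).

Row analogue of `barlow_lineCount_le_payers` (`…BarlowLineCount`, the zig|zig corner): the conclusion has the shape of the inner
conclusion of lane T's v3 `hlines` for the row sets — `∃ m ≥ 0, ∃ T₃ T₄ ⊇ {(k,j) : «++» c-layer k ∧ ∃ i, the site L(layerSite σ L z k i j)+s
lies in the window band at lateral ≤ ρ − m}, #T₃ + #T₄ ≤ Σ_PAY(12−deg)` (weights `rowW = 1` on both plates; the zig sets are weight `0`
in this corner).  Assembly: `rowSet_of_sites` (rows through the window balls) filtered to the «++» layers, `rowLineFamily_spec`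
(crossing sites), `barlowRowRow_card_le_payers`.
* **`barlow_rowRow_hlines`** — the ROW|ROW corner in lane T's cell-quantified `hlines` shape: per cell `∃ m ≥ 0, T₃ T₄ ⊇ «++» window
  rows at ρ − m, #T₃ + #T₄ + 36·m·ρ ≤ Σ_PAY(12−deg) + (540 + 384R₀)(1+h)ρ` (m = 5 + (8/3)(h+4R₀)).
WHAT REMAINS: the two mixed corners in the same format (next file) and lane T's `18·m·ρ ≤ C_w(1+h)ρ` bookkeeping; F-C1 not moved.
-/

noncomputable section

namespace Summit.Ventures.Crystal3D.Theorems

open Finset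
open Literature.MathematicalPhysics.StatisticalMechanics
open Summit.Ventures.Crystal3D.Cruxes.TextureLiminf.TexShadow (stacking cyl bestLayerDir bestLayerAxis norm_bestLayerDir)
open scoped InnerProductSpace

variable {X : Finset (EuclideanSpace ℝ (Fin 3))}

open scoped Classical in
/-- **ROW | ROW** (no presentation constraint).  See the module docstring. -/
theorem barlow_rowRow_hlines
    {sE : EuclideanSpace ℝ (Fin 3)} (hsE : sE ∈ fccSlots) (hcert : ExactOnly 0 (fccSlots.filter fun w => 0 < ⟪w, sE⟫_ℝ))
    (hDS : ∀ F₁ F₂ : EuclideanSpace ℝ (Fin 3) ≃ₗᵢ[ℝ] EuclideanSpace ℝ (Fin 3), DoubleStarCoaxialAt F₁ F₂) (hCP : CapPairCoaxial)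
    {σ₁ σ₂ : ℤ → ℤ} (hσ₁ : IsHaggSeq σ₁) (hσ₂ : IsHaggSeq σ₂)
    (L₁ L₂ : EuclideanSpace ℝ (Fin 3) ≃ₗᵢ[ℝ] EuclideanSpace ℝ (Fin 3)) (s₁ s₂ : EuclideanSpace ℝ (Fin 3))
    (hrow₁ : Real.sqrt 2 / 2 ≤ ⟪L₁ (bestLayerDir L₁ (EuclideanSpace.single (2 : Fin 3) (1 : ℝ))), EuclideanSpace.single (2 : Fin 3) (1 : ℝ)⟫_ℝ)
    (hrow₂ : Real.sqrt 2 / 2 ≤ ⟪L₂ (bestLayerDir L₂ (-EuclideanSpace.single (2 : Fin 3) (1 : ℝ))), -EuclideanSpace.single (2 : Fin 3) (1 : ℝ)⟫_ℝ)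
    (hoff₁ : ∀ y ∈ reachSet L₁ (L₁ ((haggLabel σ₁ 0 : ℝ) • barlowOffset 1) + s₁)
      (insert (twinFrame L₁ (L₁ (EuclideanSpace.single (2 : Fin 3) (1 : ℝ))))
        (chainFrames (EuclideanSpace.single (2 : Fin 3) (1 : ℝ)) L₁ (bestLayerDir L₁ (EuclideanSpace.single (2 : Fin 3) (1 : ℝ))))),
      y ∉ stacking L₂ s₂ σ₂)
    (hoff₂ : ∀ y ∈ reachSet L₂ (L₂ ((haggLabel σ₂ 0 : ℝ) • barlowOffset 1) + s₂)
      (insert (twinFrame L₂ (L₂ (EuclideanSpace.single (2 : Fin 3) (1 : ℝ))))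
        (chainFrames (-EuclideanSpace.single (2 : Fin 3) (1 : ℝ)) L₂ (bestLayerDir L₂ (-EuclideanSpace.single (2 : Fin 3) (1 : ℝ))))),
      y ∉ stacking L₁ s₁ σ₁)
    (hdisjR : ∀ y ∈ reachSet L₁ (L₁ ((haggLabel σ₁ 0 : ℝ) • barlowOffset 1) + s₁)
      (insert (twinFrame L₁ (L₁ (EuclideanSpace.single (2 : Fin 3) (1 : ℝ))))
        (chainFrames (EuclideanSpace.single (2 : Fin 3) (1 : ℝ)) L₁ (bestLayerDir L₁ (EuclideanSpace.single (2 : Fin 3) (1 : ℝ))))),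
      y ∉ reachSet L₂ (L₂ ((haggLabel σ₂ 0 : ℝ) • barlowOffset 1) + s₂)
        (insert (twinFrame L₂ (L₂ (EuclideanSpace.single (2 : Fin 3) (1 : ℝ))))
          (chainFrames (-EuclideanSpace.single (2 : Fin 3) (1 : ℝ)) L₂ (bestLayerDir L₂ (-EuclideanSpace.single (2 : Fin 3) (1 : ℝ))))))
    (R₀ : ℝ) (hR₀ : 6 ≤ R₀) :
    ∀ h : ℝ, 0 ≤ h → ∀ ρ : ℝ, R₀ ≤ ρ → ∀ X P₁ P₂ : Finset (EuclideanSpace ℝ (Fin 3)),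
      (∀ p ∈ X, ∀ q ∈ X, p ≠ q → 1 ≤ dist p q) → P₁ ⊆ X → P₂ ⊆ X \ P₁ → (∀ p ∈ X, p ∈ cyl R₀ h ρ) →
      (∀ p, p ∈ P₁ ↔ (p ∈ stacking L₁ s₁ σ₁ ∧ -(2 * R₀) ≤ p 2 ∧ p 2 ≤ -R₀ ∧ p 0 ^ 2 + p 1 ^ 2 ≤ ρ ^ 2)) →
      (∀ p, p ∈ P₂ ↔ (p ∈ stacking L₂ s₂ σ₂ ∧ h + R₀ ≤ p 2 ∧ p 2 ≤ h + 2 * R₀ ∧ p 0 ^ 2 + p 1 ^ 2 ≤ ρ ^ 2)) →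
      ∃ (m : ℝ) (T₃ T₄ : Finset (ℤ × ℤ)), 0 ≤ m ∧
        (∀ kj : ℤ × ℤ, ((σ₁ kj.1 = 1 ∧ σ₁ (kj.1 - 1) = 1) ∧ ∃ i : ℤ,
          -R₀ - 4 ≤ (L₁ (layerSite σ₁ L₁ (EuclideanSpace.single (2 : Fin 3) (1 : ℝ)) kj.1 i kj.2) + s₁) 2 ∧
          (L₁ (layerSite σ₁ L₁ (EuclideanSpace.single (2 : Fin 3) (1 : ℝ)) kj.1 i kj.2) + s₁) 2 ≤ -R₀ - 3 ∧
          Real.sqrt ((L₁ (layerSite σ₁ L₁ (EuclideanSpace.single (2 : Fin 3) (1 : ℝ)) kj.1 i kj.2) + s₁) 0 ^ 2 +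
            (L₁ (layerSite σ₁ L₁ (EuclideanSpace.single (2 : Fin 3) (1 : ℝ)) kj.1 i kj.2) + s₁) 1 ^ 2) ≤ ρ - m) → kj ∈ T₃) ∧
        (∀ kj : ℤ × ℤ, ((σ₂ kj.1 = 1 ∧ σ₂ (kj.1 - 1) = 1) ∧ ∃ i : ℤ,
          h + R₀ + 3 ≤ (L₂ (layerSite σ₂ L₂ (-EuclideanSpace.single (2 : Fin 3) (1 : ℝ)) kj.1 i kj.2) + s₂) 2 ∧
          (L₂ (layerSite σ₂ L₂ (-EuclideanSpace.single (2 : Fin 3) (1 : ℝ)) kj.1 i kj.2) + s₂) 2 ≤ h + R₀ + 4 ∧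
          Real.sqrt ((L₂ (layerSite σ₂ L₂ (-EuclideanSpace.single (2 : Fin 3) (1 : ℝ)) kj.1 i kj.2) + s₂) 0 ^ 2 +
            (L₂ (layerSite σ₂ L₂ (-EuclideanSpace.single (2 : Fin 3) (1 : ℝ)) kj.1 i kj.2) + s₂) 1 ^ 2) ≤ ρ - m) → kj ∈ T₄) ∧
        (T₃.card : ℝ) + T₄.card + 36 * m * ρ ≤
          (∑ y ∈ X.filter (fun y => (X.filter fun q => dist y q = 1).card ≠ 12 ∧ -R₀ - 2 ≤ y 2 ∧ y 2 ≤ h + R₀ + 2),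
            ((12 : ℝ) - ((X.filter fun q => dist y q = 1).card : ℝ))) + (540 + 384 * R₀) * (1 + h) * ρ := by
  intro h hh ρ hρ X P₁ P₂ hX hP₁X hP₂X' hcyl hP₁ hP₂
  have hP₂X : P₂ ⊆ X := hP₂X'.trans Finset.sdiff_subset
  have hcell : ∀ p ∈ X, -(2 * R₀) ≤ p 2 ∧ p 2 ≤ h + 2 * R₀ ∧ p 0 ^ 2 + p 1 ^ 2 ≤ ρ ^ 2 := fun p hp => by
    have := hcyl p hp; simpa only [cyl, Set.mem_setOf_eq] using this
  have hρ1 : (1 : ℝ) ≤ ρ := by linarith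
  set m : ℝ := 5 + 8 / 3 * (h + 4 * R₀) with hm
  set e₃ : EuclideanSpace ℝ (Fin 3) := EuclideanSpace.single (2 : Fin 3) (1 : ℝ) with he₃
  have he₃i : ∀ d : EuclideanSpace ℝ (Fin 3), ⟪d, e₃⟫_ℝ = d 2 := fun d => by rw [he₃, EuclideanSpace.inner_single_right]; simp
  have hzti : ∀ d : EuclideanSpace ℝ (Fin 3), ⟪d, -e₃⟫_ℝ = -d 2 := fun d => by rw [inner_neg_right, he₃i]
  set w₁ : EuclideanSpace ℝ (Fin 3) := bestLayerDir L₁ e₃ with hw₁def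
  set w₂ : EuclideanSpace ℝ (Fin 3) := bestLayerDir L₂ (-e₃) with hw₂def
  have hw₁s : w₁ ∈ fccSlots := bestLayerDir_mem_fccSlots L₁ e₃
  have hw₂s : w₂ ∈ fccSlots := bestLayerDir_mem_fccSlots L₂ (-e₃)
  obtain ⟨a₀, b₀, a₁, b₁, hdet₁, hw₁, hw₁'⟩ := exists_rowCoeffs L₁ e₃
  obtain ⟨c₀, d₀, c₁, d₁, hdet₂, hw₂, hw₂'⟩ := exists_rowCoeffs L₂ (-e₃)
  -- the steepness in `rowLineFamily_spec`'s form
  have hs2 : (0 : ℝ) < Real.sqrt 2 / 2 := by positivity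
  -- margin and radii
  have hm0 : 0 ≤ m := by rw [hm]; positivity
  set ρw : ℝ := ρ - m with hρw
  set ρin : ℝ := ρw + 2 with hρin
  have hρin' : ρin + 8 / 3 * (h + 4 * R₀) + 2 ≤ ρ - 1 := by rw [hρin, hρw, hm]; linarith
  have hinvδ : 1 / (Real.sqrt 2 / 2) ≤ 2 := by
    rw [div_le_iff₀ hs2]
    have : (1 : ℝ) ≤ Real.sqrt 2 := by
      rw [show (1 : ℝ) = Real.sqrt 1 by simp]; exact Real.sqrt_le_sqrt (by norm_num)
    linarith
  -- the window balls and their row sets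
  set W₁ : Finset (EuclideanSpace ℝ (Fin 3)) := P₁.filter fun q => -R₀ - 4 ≤ q 2 ∧ q 2 ≤ -R₀ - 3 ∧ Real.sqrt (q 0 ^ 2 + q 1 ^ 2) ≤ ρw
    with hW₁
  set W₂ : Finset (EuclideanSpace ℝ (Fin 3)) := P₂.filter fun q => h + R₀ + 3 ≤ q 2 ∧ q 2 ≤ h + R₀ + 4 ∧ Real.sqrt (q 0 ^ 2 + q 1 ^ 2) ≤ ρw
    with hW₂
  have hW₁site : ∀ q ∈ W₁, ∃ k i j : ℤ, q = L₁ (barlowPos 1 (Real.sqrt (2 / 3)) σ₁ k i j) + s₁ := by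
    intro q hq
    obtain ⟨hqP, -⟩ := Finset.mem_filter.1 hq
    obtain ⟨r, ⟨k, i, j, rfl⟩, hr⟩ := ((hP₁ q).1 hqP).1
    exact ⟨k, i, j, hr.symm⟩
  have hW₂site : ∀ q ∈ W₂, ∃ k i j : ℤ, q = L₂ (barlowPos 1 (Real.sqrt (2 / 3)) σ₂ k i j) + s₂ := by
    intro q hq
    obtain ⟨hqP, -⟩ := Finset.mem_filter.1 hq
    obtain ⟨r, ⟨k, i, j, rfl⟩, hr⟩ := ((hP₂ q).1 hqP).1
    exact ⟨k, i, j, hr.symm⟩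
  obtain ⟨Tr₁, hTr₁in, hTr₁out, -⟩ := rowSet_of_sites σ₁ L₁ s₁ e₃ hdet₁ hw₁ hw₁' W₁ hW₁site
  obtain ⟨Tr₂, hTr₂in, hTr₂out, -⟩ := rowSet_of_sites σ₂ L₂ s₂ (-e₃) hdet₂ hw₂ hw₂' W₂ hW₂site
  -- restrict to the «++» c-layers
  set T₃ : Finset (ℤ × ℤ) := Tr₁.filter fun kj => σ₁ kj.1 = 1 ∧ σ₁ (kj.1 - 1) = 1 with hT₃
  set T₄ : Finset (ℤ × ℤ) := Tr₂.filter fun kj => σ₂ kj.1 = 1 ∧ σ₂ (kj.1 - 1) = 1 with hT₄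
  -- the window property of the chosen rows
  have hwin₁ : ∀ kj ∈ T₃, ∃ i : ℤ, (-R₀ - 4) ≤ ⟪L₁ (layerSite σ₁ L₁ e₃ kj.1 i kj.2) + s₁, e₃⟫_ℝ ∧
      ⟪L₁ (layerSite σ₁ L₁ e₃ kj.1 i kj.2) + s₁, e₃⟫_ℝ ≤ (-R₀ - 4) + 1 ∧
      Real.sqrt ((L₁ (layerSite σ₁ L₁ e₃ kj.1 i kj.2) + s₁) 0 ^ 2 + (L₁ (layerSite σ₁ L₁ e₃ kj.1 i kj.2) + s₁) 1 ^ 2) ≤ ρw := by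
    intro kj hkj
    obtain ⟨i, hi⟩ := hTr₁out kj (Finset.mem_filter.1 hkj).1
    obtain ⟨-, h1, h2, h3⟩ := Finset.mem_filter.1 hi
    exact ⟨i, by rw [he₃i]; exact h1, by rw [he₃i]; linarith, h3⟩
  have hwin₂ : ∀ kj ∈ T₄, ∃ i : ℤ, (-(h + R₀) - 4) ≤ ⟪L₂ (layerSite σ₂ L₂ (-e₃) kj.1 i kj.2) + s₂, -e₃⟫_ℝ ∧
      ⟪L₂ (layerSite σ₂ L₂ (-e₃) kj.1 i kj.2) + s₂, -e₃⟫_ℝ ≤ (-(h + R₀) - 4) + 1 ∧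
      Real.sqrt ((L₂ (layerSite σ₂ L₂ (-e₃) kj.1 i kj.2) + s₂) 0 ^ 2 + (L₂ (layerSite σ₂ L₂ (-e₃) kj.1 i kj.2) + s₂) 1 ^ 2) ≤ ρw := by
    intro kj hkj
    obtain ⟨i, hi⟩ := hTr₂out kj (Finset.mem_filter.1 hkj).1
    obtain ⟨-, h1, h2, h3⟩ := Finset.mem_filter.1 hi
    exact ⟨i, by rw [hzti]; linarith, by rw [hzti]; linarith, h3⟩
  obtain ⟨ai₁, bi₁, hfam₁⟩ := rowLineFamily_spec σ₁ L₁ s₁ e₃ hdet₁ hw₁ hw₁' hs2 hrow₁ (-R₀ - 4) ρw T₃ hwin₁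
  obtain ⟨ai₂, bi₂, hfam₂⟩ := rowLineFamily_spec σ₂ L₂ s₂ (-e₃) hdet₂ hw₂ hw₂' hs2 hrow₂ (-(h + R₀) - 4) ρw T₄ hwin₂
  -- fuel
  set N : ℕ := ⌈8 * (h + 4 * R₀) / 3⌉₊ + 1 with hN
  have hNfuel : 8 * (h + 4 * R₀) < 3 * (N : ℝ) := by
    rw [hN]; push_cast
    have h1 := Nat.le_ceil (8 * (h + 4 * R₀) / 3)
    linarith
  -- the two-family count
  have hcount := barlowRowRow_card_le_payers hX hsE hcert hDS hCP hσ₁ hσ₂ L₁ L₂ s₁ s₂ R₀ h ρ hR₀ hh hρ1 P₁ P₂ hP₁X hP₂X hcell hP₁ hP₂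
    hw₁s a₀ b₀ hw₁ hrow₁ hw₂s c₀ d₀ hw₂ hrow₂ hoff₁ hoff₂ hdisjR (-R₀ - 4) (-(h + R₀) - 4) ρin
    (by linarith) (by linarith) (by linarith) (by linarith) hρin'
    T₃ T₄ (fun kj => kj.1) ai₁ bi₁ (fun kj => kj.1) ai₂ bi₂
    (fun kj hkj => (Finset.mem_filter.1 hkj).2)
    (fun kj hkj => (hfam₁ kj hkj).2.1) (fun kj hkj => (hfam₁ kj hkj).2.2.2.1)
    (fun kj hkj kj' hkj' heq => (hfam₁ kj hkj).2.2.2.2.2 kj' hkj' heq)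
    (fun kj hkj => by have := (hfam₁ kj hkj).2.2.2.2.1; rw [hρin]; linarith)
    (fun kj hkj => (Finset.mem_filter.1 hkj).2)
    (fun kj hkj => (hfam₂ kj hkj).2.1) (fun kj hkj => (hfam₂ kj hkj).2.2.2.1)
    (fun kj hkj kj' hkj' heq => (hfam₂ kj hkj).2.2.2.2.2 kj' hkj' heq)
    (fun kj hkj => by have := (hfam₂ kj hkj).2.2.2.2.1; rw [hρin]; linarith)
    hNfuel
  have hρ0 : 0 ≤ ρ := by linarith
  have hpen : 36 * m * ρ ≤ (540 + 384 * R₀) * (1 + h) * ρ := by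
    have h1 : 36 * m ≤ (540 + 384 * R₀) * (1 + h) := by rw [hm]; nlinarith
    exact mul_le_mul_of_nonneg_right h1 hρ0
  refine ⟨m, T₃, T₄, hm0, fun kj ⟨hcc, i, h1, h2, h3⟩ => ?_, fun kj ⟨hcc, i, h1, h2, h3⟩ => ?_, by linarith [hcount, hpen]⟩
  · -- a window row site at lateral ≤ ρ − m = ρw is a ball of W₁
    set q := L₁ (layerSite σ₁ L₁ e₃ kj.1 i kj.2) + s₁ with hq
    have h0 : 0 ≤ q 0 ^ 2 + q 1 ^ 2 := by positivity
    have hle : Real.sqrt (q 0 ^ 2 + q 1 ^ 2) ≤ ρ := by linarith only [h3, hm0]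
    have hlat2 : q 0 ^ 2 + q 1 ^ 2 ≤ ρ ^ 2 := by
      have h7 := pow_le_pow_left₀ (Real.sqrt_nonneg _) hle 2
      rwa [Real.sq_sqrt h0] at h7
    have hqP : q ∈ P₁ := (hP₁ _).2 ⟨layerSite_mem_stacking σ₁ L₁ e₃ s₁ kj.1 i kj.2, by linarith only [h1, hR₀], by linarith only [h2], hlat2⟩
    have hqW : q ∈ W₁ := by rw [hW₁, Finset.mem_filter]; exact ⟨hqP, h1, h2, h3⟩
    rw [hT₃, Finset.mem_filter]
    exact ⟨hTr₁in kj ⟨i, hqW⟩, hcc⟩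
  · set q := L₂ (layerSite σ₂ L₂ (-e₃) kj.1 i kj.2) + s₂ with hq
    have h0 : 0 ≤ q 0 ^ 2 + q 1 ^ 2 := by positivity
    have hle : Real.sqrt (q 0 ^ 2 + q 1 ^ 2) ≤ ρ := by linarith only [h3, hm0]
    have hlat2 : q 0 ^ 2 + q 1 ^ 2 ≤ ρ ^ 2 := by
      have h7 := pow_le_pow_left₀ (Real.sqrt_nonneg _) hle 2
      rwa [Real.sq_sqrt h0] at h7
    have hqP : q ∈ P₂ := (hP₂ _).2 ⟨layerSite_mem_stacking σ₂ L₂ (-e₃) s₂ kj.1 i kj.2, by linarith only [h1], by linarith only [h2, hR₀], hlat2⟩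
    have hqW : q ∈ W₂ := by rw [hW₂, Finset.mem_filter]; exact ⟨hqP, h1, h2, h3⟩
    rw [hT₄, Finset.mem_filter]
    exact ⟨hTr₂in kj ⟨i, hqW⟩, hcc⟩


end Summit.Ventures.Crystal3D.Theorems

end
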